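import Summits.CriticalPhenomena.PercolationContinuityZ3.Theorems.Transplant.SiteSetExploration
import HarnessLib

/-!
# SITE percolation: the site exploration of a source set — what it reveals, self-determination, and the hybrid configuration
# (WP3 step 1 of P1-SITE-Z3 §16, part 2; site twin of `L/SetClusterExploration.lean`)

builds on p205010 (kernel theorem, internal audit signed; external expert review pending).

Continuation of `SiteSetExploration.lean`: `mem_reached_iff` (reached = site cluster of `N` inside `D`), `mem_revealedAt_iff` (revealed =
sources ∪ cluster ∪ vertex boundary, the complement of the site world), self-determination (`selfDetermined_revealedAt`), the hybrid
`K₁ →_{S_N(K₁)} K₂` (`fin_splice`, `reached_splice`, `revealedAt_splice`) and **`sC_splice_of_not_mem_reached`** (outside the explored cluster the hybrid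
is `K₂` read on the site world `D ∖ S_N(K₁)`).
Support file (`--supports stmt-CriticalPhenomena-4575 --as helper`); no definitions, no named facts, no sorries.
[cite: Gladkov2024, Example 2.5, Lemma 3.1] [cite: VandenbergHaggstromKahn2005, §1 p. 4, eq. (6)]
-/

noncomputable section

open Classical

namespace Summit.CriticalPhenomena.PercolationContinuityZ3.Theorems.Transplant

namespace SiteSetExploration

open Finset
open Literature.Probability.Percolation
open Literature.Probability.Percolation.DecisionTree
open SiteBHK (sC)

variable {V : Type*} [Fintype V] [DecidableEq V] {Γ : SimpleGraph V}

section Invariant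

variable {D : Finset V} {N : Finset V} {K : Finset V}

/-! ### What the exploration reveals -/

omit [Fintype V] [DecidableEq V] in
/-- A set containing the start of a walk and closed under adjacency along the walk's graph contains its end. [folklore] -/
private theorem mem_of_walk_closed {G : SimpleGraph V} {S : Set V}
    (hS : ∀ a b, G.Adj a b → a ∈ S → b ∈ S) {u v : V} (p : G.Walk u v) (hu : u ∈ S) : v ∈ S := by
  induction p with
  | nil => exact hu
  | cons hadj _ ih => exact ih (hS _ _ hadj hu)

omit [Fintype V] in
/-- An unrevealed vertex of `D` adjacent to a reached vertex contradicts termination; so a neighbour in `D` of a reached vertex is revealed.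
[folklore] -/
theorem mem_rev_of_adj {K : Finset V} {r u : V} (hr : r ∈ reached Γ D N K) (hu : u ∈ D) (h : Γ.Adj r u) :
    u ∈ revealedAt Γ D N K := by
  by_contra hrev
  have hmem : u ∈ bnd Γ D N (fin Γ D N K) := mem_bnd.2 ⟨⟨hu, hrev⟩, Or.inr ⟨r, hr, h⟩⟩
  rw [bnd_fin] at hmem
  exact notMem_empty _ hmem

omit [Fintype V] in
/-- A source in `D` is revealed. [folklore] -/
theorem mem_rev_of_mem_source {K : Finset V} {s : V} (hs : s ∈ N) (hsD : s ∈ D) : s ∈ revealedAt Γ D N K := by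
  by_contra hrev
  have hmem : s ∈ bnd Γ D N (fin Γ D N K) := mem_bnd.2 ⟨⟨hsD, hrev⟩, Or.inl hs⟩
  rw [bnd_fin] at hmem
  exact notMem_empty _ hmem

omit [Fintype V] in
/-- **The reached set is the site cluster of `N` inside `D`.** [cite: Gladkov2024, §2 Example 2.5] -/
theorem mem_reached_iff {v : V} :
    v ∈ reached Γ D N K ↔ ∃ s ∈ N, v ∈ sC Γ D s (↑K : Set V) := by
  have hI := inv_fin (Γ := Γ) (D := D) (N := N) K
  constructor
  · intro hv
    obtain ⟨s, hs, hsvis, hsv⟩ := hI.reach v hv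
    have hsub : (↑(fin Γ D N K).vis : Set V) ⊆ (↑K : Set V) ∩ ↑D := fun w hw =>
      ⟨mem_coe.2 (hI.vis_sub w (mem_coe.1 hw)).2, mem_coe.2 (hI.rev_sub (hI.vis_sub w (mem_coe.1 hw)).1)⟩
    refine ⟨s, hs, hsub (mem_coe.2 hsvis), hsub (mem_coe.2 hv), hsv.mono (SiteBHK.siteOpenGraph_mono hsub)⟩
  · rintro ⟨s, hs, ⟨hsK, hsD⟩, ⟨hvK, hvD⟩, hr⟩
    have hsD' : s ∈ D := mem_coe.1 hsD
    have hsvis : s ∈ (fin Γ D N K).vis := hI.open_vis s (mem_rev_of_mem_source hs hsD') (mem_coe.1 hsK)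
    obtain ⟨p⟩ := hr
    have hclosed : ∀ a b, (siteOpenGraph Γ ((↑K : Set V) ∩ ↑D)).Adj a b →
        a ∈ (↑(fin Γ D N K).vis : Set V) → b ∈ (↑(fin Γ D N K).vis : Set V) := by
      intro a b hab ha
      rw [siteOpenGraph_adj] at hab
      obtain ⟨hadj, -, hbK, hbD⟩ := hab
      have hbrev : b ∈ (fin Γ D N K).rev := mem_rev_of_adj (mem_coe.1 ha) (mem_coe.1 hbD) hadj
      exact mem_coe.2 (hI.open_vis b hbrev (mem_coe.1 hbK))
    exact mem_coe.1 (mem_of_walk_closed hclosed p (mem_coe.2 hsvis))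

omit [Fintype V] in
/-- **The revealed set**: the sources in `D` and the vertices of `D` adjacent to the cluster of `N` (this contains the cluster, whose vertices
are sources or neighbours of reached vertices). [cite: Gladkov2024, §2 Example 2.5] -/
theorem mem_revealedAt_iff {u : V} :
    u ∈ revealedAt Γ D N K ↔ u ∈ D ∧ (u ∈ N ∨ ∃ r ∈ reached Γ D N K, Γ.Adj r u) := by
  have hI := inv_fin (Γ := Γ) (D := D) (N := N) K
  constructor
  · intro hu
    exact ⟨hI.rev_sub hu, hI.touch u hu⟩
  · rintro ⟨huD, hN | ⟨r, hr, hru⟩⟩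
    · exact mem_rev_of_mem_source hN huD
    · exact mem_rev_of_adj hr huD hru

omit [Fintype V] in
/-- Reached vertices are revealed and open. [folklore] -/
theorem mem_of_mem_reached {v : V} (hv : v ∈ reached Γ D N K) : v ∈ revealedAt Γ D N K ∧ v ∈ K :=
  (inv_fin (Γ := Γ) (D := D) (N := N) K).vis_sub v hv

omit [Fintype V] in
/-- Open revealed vertices are reached. [folklore] -/
theorem mem_reached_of_mem_revealedAt {u : V} (hu : u ∈ revealedAt Γ D N K) (huK : u ∈ K) : u ∈ reached Γ D N K :=
  (inv_fin (Γ := Γ) (D := D) (N := N) K).open_vis u hu huK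

/-! ### Self-determination -/

omit [Fintype V] in
/-- A step depends on the configuration only through the vertex it reveals. [cite: Gladkov2024, Lemma 3.1] -/
theorem step_congr {K K' : Finset V} {σ : SSt V}
    (h : ∀ u ∈ (step Γ D N K σ).rev, (u ∈ K ↔ u ∈ K')) : step Γ D N K' σ = step Γ D N K σ := by
  by_cases hh : bnd Γ D N σ = ∅
  · rw [step_of_bnd_eq_empty hh, step_of_bnd_eq_empty hh]
  obtain ⟨u, -, hpick, hstep⟩ := step_of_bnd_ne_empty (K := K) hh
  obtain ⟨u', -, hpick', hstep'⟩ := step_of_bnd_ne_empty (K := K') hh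
  rw [hpick, Option.some.injEq] at hpick'
  subst hpick'
  have hu : u ∈ (step Γ D N K σ).rev := by
    rw [hstep]; split_ifs <;> exact mem_insert_self u σ.rev
  have hiff := h u hu
  rw [hstep', hstep]
  by_cases hK : u ∈ K
  · rw [if_pos hK, if_pos (hiff.1 hK)]
  · rw [if_neg hK, if_neg (fun h' => hK (hiff.2 h'))]

omit [Fintype V] in
/-- The run depends on the configuration only through the revealed vertices. [cite: Gladkov2024, Lemma 3.1] -/
theorem run_congr {K K' : Finset V} :
    ∀ k, (∀ u ∈ (run Γ D N K k).rev, (u ∈ K ↔ u ∈ K')) → run Γ D N K' k = run Γ D N K k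
  | 0, _ => rfl
  | k + 1, h => by
      have ih := run_congr k fun u hu => h u (rev_subset_step K _ hu)
      rw [run_succ, run_succ, ih]
      exact step_congr h

omit [Fintype V] in
/-- **Self-determination.** [cite: Gladkov2024, Lemma 3.1] -/
theorem fin_congr {K K' : Finset V} (h : ∀ u ∈ revealedAt Γ D N K, (u ∈ K ↔ u ∈ K')) :
    fin Γ D N K' = fin Γ D N K := run_congr _ h

omit [Fintype V] in
/-- `K ↦ S_N(K)` is self-determined. [cite: Gladkov2024, Lemma 3.1] -/
theorem selfDetermined_revealedAt : SelfDetermined (revealedAt Γ D N) :=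
  fun _ _ h => congrArg SSt.rev (fin_congr h)

/-! ### The hybrid `K₁ →_{S_N(K₁)} K₂` -/

omit [Fintype V] in
/-- The hybrid agrees with `K₁` on the revealed set, hence is explored identically. [cite: Gladkov2024, Lemma 3.1] -/
theorem fin_splice (K₁ K₂ : Finset V) :
    fin Γ D N (splice (revealedAt Γ D N K₁) K₁ K₂) = fin Γ D N K₁ :=
  fin_congr fun u hu => (splice_agree _ K₁ K₂ u hu).symm

omit [Fintype V] in
/-- The hybrid has the same cluster of `N` as `K₁`. [cite: Gladkov2024, Lemma 3.1] -/
theorem reached_splice (K₁ K₂ : Finset V) :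
    reached Γ D N (splice (revealedAt Γ D N K₁) K₁ K₂) = reached Γ D N K₁ :=
  congrArg SSt.vis (fin_splice K₁ K₂)

omit [Fintype V] in
/-- The hybrid reveals the same set as `K₁`. [cite: Gladkov2024, Lemma 3.1] -/
theorem revealedAt_splice (K₁ K₂ : Finset V) :
    revealedAt Γ D N (splice (revealedAt Γ D N K₁) K₁ K₂) = revealedAt Γ D N K₁ :=
  congrArg SSt.rev (fin_splice K₁ K₂)

omit [Fintype V] [DecidableEq V] in
/-- The cluster of a vertex outside the world is empty. [folklore] -/
theorem sC_eq_empty_of_notMem_U {U : Finset V} {s : V} {ω : Set V} (hs : s ∉ U) : sC Γ U s ω = ∅ :=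
  Set.eq_empty_of_forall_notMem fun _ hy => hs hy.1.2

omit [Fintype V] in
/-- **The world outside the explored cluster (site).**  For a vertex `x` outside the cluster of `N` of `K₁`, the site cluster of `x` inside `D` in
the hybrid `K₁ →_{S_N(K₁)} K₂` is its site cluster in `K₂` inside the site world `D ∖ S_N(K₁)`: an open path from outside the revealed set never
enters it (an open revealed vertex is reached, and the `D`-neighbours of reached vertices are revealed). [cite: VandenbergHaggstromKahn2005, eq. (6) (p. 4)] -/
theorem sC_splice_of_not_mem_reached {K₁ K₂ : Finset V} {x : V} (hx : x ∉ reached Γ D N K₁) :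
    sC Γ D x (↑(splice (revealedAt Γ D N K₁) K₁ K₂) : Set V) =
      sC Γ (D \ revealedAt Γ D N K₁) x (↑K₂ : Set V) := by
  set S := revealedAt Γ D N K₁ with hS
  set H := splice S K₁ K₂ with hH
  -- an open-in-the-hybrid `D`-neighbour of a vertex of `D` outside `S` is outside `S`
  have hout : ∀ a b : V, a ∈ D → a ∉ S → b ∈ D → b ∈ H → Γ.Adj a b → b ∉ S := by
    intro a b haD haS hbD hbH hab hbS
    have hbK₁ : b ∈ K₁ := (splice_agree S K₁ K₂ b hbS).1 hbH
    exact haS (mem_rev_of_adj (mem_reached_of_mem_revealedAt hbS hbK₁) haD hab.symm)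
  have hHK₂ : ∀ v : V, v ∉ S → (v ∈ H ↔ v ∈ K₂) := fun v hv => by
    rw [hH, mem_splice]; constructor
    · rintro (⟨h, -⟩ | ⟨-, h⟩); exacts [absurd h hv, h]
    · exact fun h => Or.inr ⟨hv, h⟩
  by_cases hxS : x ∈ S
  · -- `x` revealed but not reached: closed in `K₁`, hence in the hybrid; and outside the world
    have hxK₁ : x ∉ K₁ := fun h => hx (mem_reached_of_mem_revealedAt hxS h)
    have hxH : x ∉ (↑H : Set V) := fun h => hxK₁ ((splice_agree S K₁ K₂ x hxS).1 (mem_coe.1 h))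
    rw [SiteBHK.sC_eq_empty_of_notMem hxH, sC_eq_empty_of_notMem_U (by rw [mem_sdiff, not_and, not_not]; exact fun _ => hxS)]
  ext y
  constructor
  · rintro ⟨⟨hxH, hxD⟩, ⟨hyH, hyD⟩, hr⟩
    have hxD' : x ∈ D := hxD
    rw [SimpleGraph.reachable_iff_reflTransGen] at hr
    -- along the path every vertex stays outside `S`, and the path is a `K₂`-path of the world
    have key : ∀ c, Relation.ReflTransGen (siteOpenGraph Γ ((↑H : Set V) ∩ ↑D)).Adj x c →
        c ∉ S ∧ (siteOpenGraph Γ ((↑K₂ : Set V) ∩ ↑(D \ S))).Reachable x c := by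
      intro c hc
      induction hc with
      | refl => exact ⟨hxS, SimpleGraph.Reachable.refl x⟩
      | @tail b c _ hbc ih =>
        obtain ⟨hadj, ⟨hbH, hbD⟩, ⟨hcH, hcD⟩⟩ := SiteBHK.adj_iff.1 hbc
        have hbD' : b ∈ D := hbD
        have hcD' : c ∈ D := hcD
        have hcS : c ∉ S := hout b c hbD' ih.1 hcD' (mem_coe.1 hcH) hadj
        refine ⟨hcS, ih.2.trans (SimpleGraph.Adj.reachable (SiteBHK.adj_iff.2 ⟨hadj, ⟨?_, ?_⟩, ⟨?_, ?_⟩⟩))⟩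
        · exact mem_coe.2 ((hHK₂ b ih.1).1 (mem_coe.1 hbH))
        · exact mem_sdiff.2 ⟨hbD', ih.1⟩
        · exact mem_coe.2 ((hHK₂ c hcS).1 (mem_coe.1 hcH))
        · exact mem_sdiff.2 ⟨hcD', hcS⟩
    obtain ⟨hyS, hreach⟩ := key y hr
    refine ⟨⟨mem_coe.2 ((hHK₂ x hxS).1 (mem_coe.1 hxH)), mem_sdiff.2 ⟨hxD', hxS⟩⟩,
      ⟨mem_coe.2 ((hHK₂ y hyS).1 (mem_coe.1 hyH)), mem_sdiff.2 ⟨hyD, hyS⟩⟩, hreach⟩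
  · rintro ⟨⟨hxK, hxU⟩, ⟨hyK, hyU⟩, hr⟩
    obtain ⟨hxD, -⟩ := mem_sdiff.1 hxU
    obtain ⟨hyD, hyS⟩ := mem_sdiff.1 hyU
    refine ⟨⟨mem_coe.2 ((hHK₂ x hxS).2 (mem_coe.1 hxK)), hxD⟩, ⟨mem_coe.2 ((hHK₂ y hyS).2 (mem_coe.1 hyK)), hyD⟩, ?_⟩
    refine hr.mono fun a b hab => ?_
    obtain ⟨hadj, ⟨haK, haU⟩, ⟨hbK, hbU⟩⟩ := SiteBHK.adj_iff.1 hab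
    obtain ⟨haD, haS⟩ := mem_sdiff.1 haU
    obtain ⟨hbD, hbS⟩ := mem_sdiff.1 hbU
    exact SiteBHK.adj_iff.2 ⟨hadj, ⟨mem_coe.2 ((hHK₂ a haS).2 (mem_coe.1 haK)), haD⟩,
      ⟨mem_coe.2 ((hHK₂ b hbS).2 (mem_coe.1 hbK)), hbD⟩⟩

end Invariant

end SiteSetExploration

end Summit.CriticalPhenomena.PercolationContinuityZ3.Theorems.Transplant
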